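import Mathlib.Tactic
import HarnessLib
import HarnessLib.Audit.Tags
import Summits.CriticalPhenomena.PercolationContinuityZ3.Theorems.PercNearOneGluingNoHeavyLowerTailSahiAntichainSplitFive
import Summits.CriticalPhenomena.PercolationContinuityZ3.Theorems.PercNearOneGluingNoHeavyLowerTailSahiAntichainSplitCosunflower

/-!
# Antichains, meets plus joins: V5 unconditionally for at most six members

Support file (seat `prim-masterthm-p1`, gen 36; `--supports stmt-CriticalPhenomena-4575`).  No `sorry`, no new definitions, standard
axioms.  Memo `run/shared/lean/prim/prim-masterthm/FROM-prim-masterthm-p1-g36-DUALITY-PROJECTION-SUNFLOWER.md`.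

SETTING (files `…SahiAntichainSplit*`): V5 says an antichain has `2 #P ≤ #meets P + #joins P + 2`; `…SplitFive` proved it for
`#P ≤ 5` (every effective point has a side with at most two members).  For `#P = 6` a point can split `3 + 3`; the three-member sides
are handled here.

NEW HERE ([this work], gen 36).
* `three_members_trichotomy`: a three-member antichain is a SUNFLOWER (all pairwise meets equal), a CO-SUNFLOWER (all pairwise joins
  equal), or has `#meets + #joins ≥ 5` — the `(2,2)` pattern is impossible: if two meets through `a` coincide (`a ∩ b = a ∩ c`) then the
  three joins are pairwise distinct (`joins_distinct_of_inter_eq`), and dually.  Equivalently: the V5-tight three-member antichains are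
  exactly the 3-sunflowers and 3-co-sunflowers (part of the gen-35 tight classification, now kernel).
* `two_mul_card_le_of_card_le_six`: **V5 for every antichain with at most six members**, unconditionally: at an effective point either a
  side has at most two members (`two_le_newLabels_of_min_le_two`), or both sides have three; then a (co)sunflower side gives
  `newLabels ≥ 2` (`…SplitSunflower`, `…SplitCosunflower`) and the split step applies, and otherwise both sides have one label to spare,
  which pays for the split even with `newLabels = 0`.  This covers the tight blow-ups of `C([4],2)` (`#P = 6`).  V1 for `#P ≤ 6` follows.
HONEST FRAMING: V5 for `#P ≥ 7` remains OPEN. [this work]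
-/

namespace Summit.CriticalPhenomena.PercolationContinuityZ3.Theorems.SahiColouredDaykin

open Finset

variable {α : Type*} [DecidableEq α]

/-! ### 1. Three members -/

/-- If two meets through `a` coincide (`a ∩ b = a ∩ c`) and `a ⊄ b`, then `a ⊄ b ∪ c`. [this work] -/
theorem not_subset_union_of_inter_eq {a b c : Finset α} (hab : ¬ a ⊆ b) (h : a ∩ b = a ∩ c) : ¬ a ⊆ b ∪ c := by
  intro hsub
  apply hab
  intro x hxa
  by_contra hxb
  rcases mem_union.1 (hsub hxa) with h' | hxc
  · exact hxb h'
  · have : x ∈ a ∩ b := by rw [h]; exact mem_inter.2 ⟨hxa, hxc⟩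
    exact hxb (mem_inter.1 this).2

/-- **Two coincident meets force three distinct joins.**  In an antichain `{a, b, c}` with `a ∩ b = a ∩ c`, the joins `a ∪ b`, `a ∪ c`,
`b ∪ c` are pairwise distinct. [this work] -/
theorem joins_distinct_of_inter_eq {a b c : Finset α} (hab : ¬ a ⊆ b) (hbc : b ≠ c) (h : a ∩ b = a ∩ c) :
    a ∪ b ≠ a ∪ c ∧ a ∪ b ≠ b ∪ c ∧ a ∪ c ≠ b ∪ c := by
  have hnot := not_subset_union_of_inter_eq hab h
  refine ⟨fun hu => hbc (eq_of_inter_eq_of_union_eq h hu), fun hu => hnot ?_, fun hu => hnot ?_⟩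
  · rw [← hu]; exact subset_union_left
  · rw [← hu]; exact subset_union_left

/-- **Two coincident joins force three distinct meets** (dual). [this work] -/
theorem meets_distinct_of_union_eq {a b c : Finset α} (hba : ¬ b ⊆ a) (hbc : b ≠ c) (h : a ∪ b = a ∪ c) :
    a ∩ b ≠ a ∩ c ∧ a ∩ b ≠ b ∩ c ∧ a ∩ c ≠ b ∩ c := by
  have hnot : ¬ b ∩ c ⊆ a := by
    intro hsub
    apply hba
    intro x hxb
    by_contra hxa
    have : x ∈ a ∪ c := by rw [← h]; exact mem_union_right _ hxb
    rcases mem_union.1 this with h' | hxc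
    · exact hxa h'
    · exact hxa (hsub (mem_inter.2 ⟨hxb, hxc⟩))
  refine ⟨fun hi => hbc (eq_of_inter_eq_of_union_eq hi h), fun hi => hnot ?_, fun hi => hnot ?_⟩
  · rw [← hi]; exact inter_subset_left
  · rw [← hi]; exact inter_subset_left

/-- Three pairwise distinct elements of a finset give `card ≥ 3`. [this work] -/
theorem three_le_card_of_mem {s : Finset (Finset α)} {x y z : Finset α} (hx : x ∈ s) (hy : y ∈ s) (hz : z ∈ s)
    (hxy : x ≠ y) (hxz : x ≠ z) (hyz : y ≠ z) : 3 ≤ #s := by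
  have hsub : ({x, y, z} : Finset (Finset α)) ⊆ s := by
    intro w hw
    rcases mem_insert.1 hw with rfl | hw
    · exact hx
    rcases mem_insert.1 hw with rfl | hw
    · exact hy
    · rw [mem_singleton.1 hw]; exact hz
  have := card_le_card hsub
  rwa [card_eq_three.2 ⟨x, y, z, hxy, hxz, hyz, rfl⟩] at this

/-- Two distinct elements of a finset give `card ≥ 2`. [this work] -/
theorem two_le_card_of_mem {s : Finset (Finset α)} {x y : Finset α} (hx : x ∈ s) (hy : y ∈ s) (hxy : x ≠ y) : 2 ≤ #s := by
  have hsub : ({x, y} : Finset (Finset α)) ⊆ s := by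
    intro w hw
    rcases mem_insert.1 hw with rfl | hw
    · exact hx
    · rw [mem_singleton.1 hw]; exact hy
  have := card_le_card hsub
  rwa [card_pair hxy] at this

/-- **Trichotomy for three-member antichains**: sunflower, co-sunflower, or `#meets + #joins ≥ 5`. [this work] -/
theorem three_members_trichotomy {Q : Finset (Finset α)} (hanti : IsAntichain (· ⊆ ·) (Q : Set (Finset α))) (h3 : #Q = 3) :
    (∃ K, ∀ a ∈ Q, ∀ a' ∈ Q, a ≠ a' → a ∩ a' = K) ∨ (∃ U, ∀ a ∈ Q, ∀ a' ∈ Q, a ≠ a' → a ∪ a' = U) ∨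
      5 ≤ #(meets Q) + #(joins Q) := by
  obtain ⟨a, b, c, hab, hac, hbc, rfl⟩ := card_eq_three.1 h3
  have ha : a ∈ ({a, b, c} : Finset (Finset α)) := by simp
  have hb : b ∈ ({a, b, c} : Finset (Finset α)) := by simp
  have hc : c ∈ ({a, b, c} : Finset (Finset α)) := by simp
  have nab : ¬ a ⊆ b := hanti (mem_coe.2 ha) (mem_coe.2 hb) hab
  have nba : ¬ b ⊆ a := hanti (mem_coe.2 hb) (mem_coe.2 ha) hab.symm
  have nca : ¬ c ⊆ a := hanti (mem_coe.2 hc) (mem_coe.2 ha) hac.symm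
  -- membership of the three meets / joins
  have mab : a ∩ b ∈ meets {a, b, c} := mem_meets_iff.2 ⟨a, ha, b, hb, hab, rfl⟩
  have mac : a ∩ c ∈ meets {a, b, c} := mem_meets_iff.2 ⟨a, ha, c, hc, hac, rfl⟩
  have mbc : b ∩ c ∈ meets {a, b, c} := mem_meets_iff.2 ⟨b, hb, c, hc, hbc, rfl⟩
  have jab : a ∪ b ∈ joins {a, b, c} := mem_joins_iff.2 ⟨a, ha, b, hb, hab, rfl⟩
  have jac : a ∪ c ∈ joins {a, b, c} := mem_joins_iff.2 ⟨a, ha, c, hc, hac, rfl⟩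
  have jbc : b ∪ c ∈ joins {a, b, c} := mem_joins_iff.2 ⟨b, hb, c, hc, hbc, rfl⟩
  -- every member pair is one of the three
  have pairs : ∀ x ∈ ({a, b, c} : Finset (Finset α)), ∀ y ∈ ({a, b, c} : Finset (Finset α)), x ≠ y →
      (x ∩ y = a ∩ b ∨ x ∩ y = a ∩ c ∨ x ∩ y = b ∩ c) ∧ (x ∪ y = a ∪ b ∨ x ∪ y = a ∪ c ∨ x ∪ y = b ∪ c) := by
    intro x hx y hy hxy
    simp only [mem_insert, mem_singleton] at hx hy
    rcases hx with rfl | rfl | rfl <;> rcases hy with rfl | rfl | rfl <;>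
      first
      | exact absurd rfl hxy
      | exact ⟨by simp [inter_comm], by simp [union_comm]⟩
  by_cases hS : a ∩ b = a ∩ c ∧ a ∩ c = b ∩ c
  · -- sunflower
    left
    refine ⟨a ∩ b, fun x hx y hy hxy => ?_⟩
    rcases (pairs x hx y hy hxy).1 with h | h | h
    · exact h
    · rw [h, hS.1]
    · rw [h, ← hS.2, hS.1]
  by_cases hC : a ∪ b = a ∪ c ∧ a ∪ c = b ∪ c
  · -- co-sunflower
    right; left
    refine ⟨a ∪ b, fun x hx y hy hxy => ?_⟩
    rcases (pairs x hx y hy hxy).2 with h | h | h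
    · exact h
    · rw [h, hC.1]
    · rw [h, ← hC.2, hC.1]
  right; right
  by_cases hM3 : a ∩ b ≠ a ∩ c ∧ a ∩ b ≠ b ∩ c ∧ a ∩ c ≠ b ∩ c
  · -- three distinct meets, at least two distinct joins
    have h3m := three_le_card_of_mem mab mac mbc hM3.1 hM3.2.1 hM3.2.2
    have h2j : 2 ≤ #(joins {a, b, c}) := by
      by_cases h1 : a ∪ b = a ∪ c
      · exact two_le_card_of_mem jac jbc fun h => hC ⟨h1, h⟩
      · exact two_le_card_of_mem jab jac h1
    omega
  · -- two meets coincide: the three joins are pairwise distinct, and at least two meets are distinct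
    have h3j : 3 ≤ #(joins {a, b, c}) := by
      push Not at hM3
      by_cases h1 : a ∩ b = a ∩ c
      · obtain ⟨d1, d2, d3⟩ := joins_distinct_of_inter_eq nab hbc h1
        exact three_le_card_of_mem jab jac jbc d1 d2 d3
      by_cases h2 : a ∩ b = b ∩ c
      · -- meets through `b` coincide: `b ∩ a = b ∩ c`
        obtain ⟨d1, d2, d3⟩ := joins_distinct_of_inter_eq nba hac (by rw [inter_comm b a, h2])
        have e1 : a ∪ b ≠ b ∪ c := by rwa [union_comm b a] at d1
        have e2 : a ∪ b ≠ a ∪ c := by rwa [union_comm b a] at d2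
        exact three_le_card_of_mem jab jac jbc e2 e1 d3.symm
      · have h3 := hM3 h1 h2
        -- meets through `c` coincide: `c ∩ a = c ∩ b`
        obtain ⟨d1, d2, d3⟩ := joins_distinct_of_inter_eq nca hab (by rw [inter_comm c a, inter_comm c b, h3])
        have e1 : a ∪ c ≠ b ∪ c := by rwa [union_comm c a, union_comm c b] at d1
        have e2 : a ∪ c ≠ a ∪ b := by rwa [union_comm c a] at d2
        have e3 : b ∪ c ≠ a ∪ b := by rwa [union_comm c b] at d3
        exact three_le_card_of_mem jab jac jbc e2.symm e3.symm e1
    have h2m : 2 ≤ #(meets {a, b, c}) := by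
      by_cases h1 : a ∩ b = a ∩ c
      · exact two_le_card_of_mem mac mbc fun h => hS ⟨h1, h⟩
      · exact two_le_card_of_mem mab mac h1
    omega

/-! ### 2. V5 for at most six members -/

/-- **V5 holds unconditionally for antichains with at most six members.** [this work] -/
theorem two_mul_card_le_of_card_le_six :
    ∀ P : Finset (Finset α), IsAntichain (· ⊆ ·) (P : Set (Finset α)) → #P ≤ 6 → 2 * #P ≤ #(meets P) + #(joins P) + 2 := by
  intro P hanti h6
  by_cases h5 : #P ≤ 5
  · exact two_mul_card_le_of_card_le_five P hanti h5
  have hP6 : #P = 6 := by omega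
  obtain ⟨r, hr⟩ := effPoints_nonempty (by omega : 2 ≤ #P)
  obtain ⟨hA, hB⟩ := mem_effPoints_iff.1 hr
  have hcard := card_above_add_card_below P r
  have hApos : 0 < #(above P r) := card_pos.2 hA
  have hBpos : 0 < #(below P r) := card_pos.2 hB
  have ihA := two_mul_card_le_of_card_le_five (above P r) (isAntichain_above hanti r) (by omega)
  have ihB := two_mul_card_le_of_card_le_five (below P r) (isAntichain_below hanti r) (by omega)
  by_cases hmin : #(above P r) ≤ 2 ∨ #(below P r) ≤ 2
  · exact two_mul_card_le_step P r (two_le_newLabels_of_min_le_two hanti hA hB hmin) ihA ihB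
  push Not at hmin
  have hA3 : #(above P r) = 3 := by omega
  have hB3 : #(below P r) = 3 := by omega
  have hsplit := card_meets_add_card_joins_split P r
  rcases three_members_trichotomy (isAntichain_above hanti r) hA3 with ⟨K, hK⟩ | ⟨U, hU⟩ | hA5
  · exact two_mul_card_le_step P r (two_le_newLabels_of_above_sunflower hanti (by omega) hB hK) ihA ihB
  · exact two_mul_card_le_step P r (two_le_newLabels_of_above_cosunflower hanti (by omega) hB hU) ihA ihB
  rcases three_members_trichotomy (isAntichain_below hanti r) hB3 with ⟨K, hK⟩ | ⟨U, hU⟩ | hB5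
  · exact two_mul_card_le_step P r (two_le_newLabels_of_below_sunflower hanti (by omega) hA hK) ihA ihB
  · exact two_mul_card_le_step P r (two_le_newLabels_of_below_cosunflower hanti (by omega) hA hU) ihA ihB
  · unfold newLabels at hsplit
    omega

/-- V1 for at most six members, unconditionally. [this work] -/
theorem card_le_or_card_le_of_card_le_six (P : Finset (Finset α)) (hanti : IsAntichain (· ⊆ ·) (P : Set (Finset α)))
    (h6 : #P ≤ 6) : #P ≤ #(meets P) + 1 ∨ #P ≤ #(joins P) + 1 :=
  card_le_or_card_le_of_two_mul_card_le (two_mul_card_le_of_card_le_six P hanti h6)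

end Summit.CriticalPhenomena.PercolationContinuityZ3.Theorems.SahiColouredDaykin
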